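import Summits.CriticalPhenomena.PercolationContinuityZ3.Theorems.PercNearOneGluingNoHeavyLowerTailSunflowerPartitionReduction
import HarnessLib
import HarnessLib.Audit

/-!
# `NoHeavyLowerTail` (crux stmt-CriticalPhenomena-4575), abstract sunflower cubic: THRESHOLD CELLS of the three-copy sum, the two
# one-coordinate RETENTION inequalities (typed conjectures), and the reduction  retention ⟹ THRESH ⟹ partition lemma

Support file (seat `prim-ineq-prove-1` gen 28; `--supports stmt-CriticalPhenomena-4575`; companion of `…SunflowerPartitionLemma` (p214317) and
`…SunflowerPartitionReduction` (p217435)).  Memo: run/shared/lean/prim/prim-ineq-prove-1/FINDING-LIFTCONE-prove1-g28.md.  The three `@[conjecture]`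
definitions are obligations of our theory, never facts: use them only as explicit hypotheses.

SETTING (`SunflowerPartition.Sunflower`): a monotone map `lab : 2^α → M₃` (`0` bottom, `1,2,3` petals, `4` top); `s6H` the polarised cubic kernel.
The THREE-COPY sum `Σ_{x,y,z ⊆ α} s6H (lab x) (lab y) (lab z) · w(x,y,z)` with PRODUCT weights is organised by THRESHOLD CELLS (ttrl lane
run/shared/lean/ttrl/dom3/DOM3.md §1, "THRESH"): a code `k e ∈ Fin 8` per coordinate prescribes which of the three copies contain `e` —
`0`: none · `1`: all three · `2`: `x` only · `3`: exactly one of `x, y` · `4`: exactly one of `x, y, z` (a FREE singly-covered coordinate) ·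
`5`: `x` and `y`, not `z` · `6`: `x` and exactly one of `y, z` · `7`: exactly two of the three (a free doubly-covered coordinate).
`Sunflower.G F k` is the sum of `s6H` over the cell of `k` (`Sunflower.inCell`).  All codes `4` is the partition functional `ZH` (`G_free_eq_ZH`);
codes in `{0,1,4,7}` are the column-sum fibres (`ZF`); general codes are the cells whose nonnegativity for every monotone `M_K`-labelling is
EQUIVALENT to coefficientwise positivity of the three-measure polarisation for every coordinatewise chain of product measures ("COMB-DOM",
DOM3.md §1; exact for `|α| ≤ 5`: 2 702 901 248 cells, 0 negative).

* `Thresh` (typed conjecture): `0 ≤ G F k` for every sunflower and every code vector.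
* `Retention3` (typed conjecture; = the memo's (MON)/(R3), census: `|α| ≤ 4` all maps × all cells, 3·10⁸ comparisons each way, `|α| = 5`
  exhaustive by kit j100612 + j100613, random `|α| ≤ 7`): turning a coordinate that lies in NO copy into a FREE singly-covered one never decreases the cell
  sum, `G F (k[e ↦ 0]) ≤ G F k` when `k e = 4`; dually `G F (k[e ↦ 1]) ≤ G F k` when `k e = 7`.  Special cases: `RestrictionMonotonicity` (MZ)
  of `…SunflowerPartitionReduction` (all other codes `4`), prim-l12-p2's `3T₂ ≥ T₃`, the chain-polarised monotonicity of memo g25 §10.11.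
* `Retention2` (typed conjecture; the memo's (R2), new): restricting the free coordinate to the top two copies keeps at least HALF:
  `G F (k[e ↦ 0]) ≤ 2 · G F k` when `k e = 3`; dually `G F (k[e ↦ 1]) ≤ 2 · G F k` when `k e = 6`.  The constants `1` and `½` are attained; together
  with `0 ≤ G F k` for `k e = 2` they are the facets `F3, F4, F1` of the (7-facet, exactly determined) realisable cone of one-coordinate lifts (memo §2).
* `thresh_of_retention : Retention3 → Retention2 → Thresh` (this work, elementary): induct on the number of coordinates with a code in `{3,4,6,7}`;
  a cell all of whose codes lie in `{0,1,2,5}` is a single chain `x ⊇ y ⊇ z`, on which `s6H ≥ 0` termwise (`s6H_nonneg_of_chain`, `decide`).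
* `G_free_eq_ZH`, `partitionLemmaH_of_thresh`, `partitionLemmaH_of_retention`: the cell with all codes free is `ZH`, so `Thresh`, and hence the two
  retention statements, imply `PartitionLemmaH` (★) — and with prim-l12-p2's clone transfer `γ`, `H_{q+t}`, `r4`, `r6`.
-/

namespace Summit.CriticalPhenomena.PercolationContinuityZ3.Theorems.SunflowerPartition

open Finset

/-! ## Codes, patterns, cells -/

/-- The membership pattern of one coordinate in the three copies, as a number `[e ∈ x] + 2[e ∈ y] + 4[e ∈ z] ∈ {0,…,7}`. [this work] -/
def patOf (bx by_ bz : Bool) : ℕ := (if bx then 1 else 0) + (if by_ then 2 else 0) + (if bz then 4 else 0)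

/-- The threshold-cell table: which membership patterns a code allows (`0`: none · `1`: all · `2`: `x` only · `3`: one of `x,y` · `4`: one of
`x,y,z` · `5`: `x,y` not `z` · `6`: `x` and one of `y,z` · `7`: exactly two). [this work] -/
def okPat (k : Fin 8) (p : ℕ) : Bool :=
  decide ((k = 0 ∧ p = 0) ∨ (k = 1 ∧ p = 7) ∨ (k = 2 ∧ p = 1) ∨ (k = 3 ∧ (p = 1 ∨ p = 2)) ∨
    (k = 4 ∧ (p = 1 ∨ p = 2 ∨ p = 4)) ∨ (k = 5 ∧ p = 3) ∨ (k = 6 ∧ (p = 3 ∨ p = 5)) ∨ (k = 7 ∧ (p = 3 ∨ p = 5 ∨ p = 6)))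

variable {α : Type*} [Fintype α] [DecidableEq α]

/-- `(x,y,z)` lies in the threshold cell of the code vector `k` (Boolean test over all coordinates). [this work] -/
def inCell (k : α → Fin 8) (x y z : Finset α) : Bool :=
  decide (∀ e, okPat (k e) (patOf (decide (e ∈ x)) (decide (e ∈ y)) (decide (e ∈ z))) = true)

/-- Unfolding `inCell`. [this work] -/
theorem inCell_iff (k : α → Fin 8) (x y z : Finset α) :
    inCell k x y z = true ↔ ∀ e, okPat (k e) (patOf (decide (e ∈ x)) (decide (e ∈ y)) (decide (e ∈ z))) = true := by
  unfold inCell; exact decide_eq_true_iff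

/-- The codes `3,4,6,7` that leave a coordinate a genuine (two- or three-way) choice (Boolean). [this work] -/
def isSplit (c : Fin 8) : Bool := decide (c = 3 ∨ c = 4 ∨ c = 6 ∨ c = 7)

/-- Unfolding `isSplit`. [this work] -/
theorem isSplit_iff (c : Fin 8) : isSplit c = true ↔ (c = 3 ∨ c = 4 ∨ c = 6 ∨ c = 7) := by
  unfold isSplit; exact decide_eq_true_iff

namespace Sunflower

variable (F : Sunflower α)

/-- The THRESHOLD-CELL SUM `G F k = Σ_{(x,y,z) ∈ cell k} s6H (lab x) (lab y) (lab z)`. [this work] -/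
def G (k : α → Fin 8) : ℤ :=
  ∑ t ∈ (univ : Finset (Finset α × Finset α × Finset α)).filter (fun t => inCell k t.1 t.2.1 t.2.2 = true),
    s6H (F.lab t.1) (F.lab t.2.1) (F.lab t.2.2)

end Sunflower

/-! ## The typed conjectures -/

/-- **THRESH** (ttrl DOM3 lane / this work; OPEN; exact for `|α| ≤ 5`): every threshold-cell sum of every sunflower of up-sets is `≥ 0`.
Equivalent to coefficientwise positivity of the three-measure polarisation of the cubic `H` along every chain of product measures (COMB-DOM);
contains the column-sum fibres (F2) and the partition lemma ★.  An obligation, never a fact. [status: open] -/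
@[conjecture] def Thresh : Prop :=
  ∀ (α : Type) [Fintype α] [DecidableEq α] (F : Sunflower α) (k : α → Fin 8), 0 ≤ F.G k

/-- **(R3) RETENTION for a free coordinate** (this work; OPEN; the memo's (MON): census `|α| ≤ 4` exhaustive over all maps and all cells,
`|α| = 5` exhaustive (kit j100612 + j100613), random `|α| ≤ 7`, 0 violations, equality attained): making an absent coordinate a free singly-covered one
never decreases the cell sum, and dually for `all three ↦ exactly two`.  Contains `RestrictionMonotonicity` (all other codes free).
An obligation, never a fact. [status: open] -/
@[conjecture] def Retention3 : Prop :=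
  ∀ (α : Type) [Fintype α] [DecidableEq α] (F : Sunflower α) (k : α → Fin 8) (e : α),
    (k e = 4 → F.G (Function.update k e 0) ≤ F.G k) ∧ (k e = 7 → F.G (Function.update k e 1) ≤ F.G k)

/-- **(R2) RETENTION ONE HALF for a top-two coordinate** (this work; OPEN; same census, constant `½` attained): if coordinate `e` is held by
exactly one of the two TOP copies, the cell sum is at least half of the cell sum with `e` absent; dually for `x` and one of `y,z` versus all three.
An obligation, never a fact. [status: open] -/
@[conjecture] def Retention2 : Prop :=
  ∀ (α : Type) [Fintype α] [DecidableEq α] (F : Sunflower α) (k : α → Fin 8) (e : α),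
    (k e = 3 → F.G (Function.update k e 0) ≤ 2 * F.G k) ∧ (k e = 6 → F.G (Function.update k e 1) ≤ 2 * F.G k)

/-! ## Pinned cells are chains -/

/-- `s6H` is nonnegative on chains of `M₃`. [this work] -/
theorem s6H_nonneg_of_chain : ∀ a b c : Fin 5, (b = a ∨ b = 0 ∨ a = 4) → (c = b ∨ c = 0 ∨ b = 4) → 0 ≤ s6H a b c := by
  decide

/-- For the PINNED codes `0,1,2,5` the allowed pattern is nested: `e ∈ z → e ∈ y → e ∈ x`. [this work] -/
theorem okPat_pinned : ∀ (c : Fin 8) (b1 b2 b3 : Bool), isSplit c = false → okPat c (patOf b1 b2 b3) = true →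
    (b3 = true → b2 = true) ∧ (b2 = true → b1 = true) := by
  unfold isSplit okPat patOf; decide

omit [Fintype α] in
/-- The non-split codes are `0,1,2,5` and a cell all of whose codes are non-split consists of chains `z ⊆ y ⊆ x`. [this work] -/
theorem chain_of_inCell_pinned [Fintype α] {k : α → Fin 8} (hk : ∀ e, isSplit (k e) = false) {x y z : Finset α}
    (h : inCell k x y z = true) : z ⊆ y ∧ y ⊆ x := by
  rw [inCell_iff] at h
  constructor
  · intro e he
    have h1 := (okPat_pinned (k e) _ _ _ (hk e) (h e)).1 (decide_eq_true he)
    exact of_decide_eq_true h1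
  · intro e he
    have h1 := (okPat_pinned (k e) _ _ _ (hk e) (h e)).2 (decide_eq_true he)
    exact of_decide_eq_true h1

namespace Sunflower

variable (F : Sunflower α)

/-- A cell without split coordinates has a nonnegative sum (every term is a chain). [this work] -/
theorem G_nonneg_of_pinned {k : α → Fin 8} (hk : ∀ e, isSplit (k e) = false) : 0 ≤ F.G k := by
  unfold G
  refine sum_nonneg fun t ht => ?_
  rw [mem_filter] at ht
  obtain ⟨hzy, hyx⟩ := chain_of_inCell_pinned hk ht.2
  exact s6H_nonneg_of_chain _ _ _ (F.lab_mono hyx) (F.lab_mono hzy)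

end Sunflower

/-! ## The reduction `Retention3 → Retention2 → Thresh` -/

omit [Fintype α] in
/-- Replacing a split code by a non-split one removes exactly that coordinate from the split set. [this work] -/
theorem filter_isSplit_update [Fintype α] (k : α → Fin 8) (e : α) (c : Fin 8) (hc : isSplit c = false)
    (he : isSplit (k e) = true) :
    (univ.filter fun e' => isSplit (Function.update k e c e') = true)
      = (univ.filter fun e' => isSplit (k e') = true).erase e := by
  ext e'
  simp only [mem_filter, mem_univ, true_and, mem_erase]
  by_cases h : e' = e
  · subst h
    simp only [Function.update_self, ne_eq, not_true_eq_false, false_and, iff_false, hc]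
    exact Bool.false_ne_true
  · rw [Function.update_of_ne h]
    exact ⟨fun hs => ⟨h, hs⟩, fun hs => hs.2⟩

/-- **Retention implies THRESH** (this work): induct on the number of split coordinates; `Retention3` disposes of the free codes `4, 7`,
`Retention2` of the two-way codes `3, 6`, and a cell without split coordinates is a sum over chains. [this work] -/
theorem thresh_of_retention (h3 : Retention3) (h2 : Retention2) : Thresh := by
  intro α _ _ F
  have key : ∀ n : ℕ, ∀ k : α → Fin 8, (univ.filter fun e => isSplit (k e) = true).card = n → 0 ≤ F.G k := by
    intro n
    induction n with
    | zero =>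
      intro k hk
      refine F.G_nonneg_of_pinned fun e => ?_
      rcases Bool.eq_false_or_eq_true (isSplit (k e)) with he | he
      · exfalso
        have hmem : e ∈ (univ.filter fun e => isSplit (k e) = true) := mem_filter.2 ⟨mem_univ _, he⟩
        rw [card_eq_zero.1 hk] at hmem
        simp at hmem
      · exact he
    | succ n ih =>
      intro k hk
      obtain ⟨e, he⟩ : (univ.filter fun e => isSplit (k e) = true).Nonempty := by
        rw [← card_pos, hk]; exact Nat.succ_pos n
      have hes : isSplit (k e) = true := (mem_filter.1 he).2
      have hcard : ∀ c : Fin 8, isSplit c = false →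
          (univ.filter fun e' => isSplit (Function.update k e c e') = true).card = n := by
        intro c hc
        rw [filter_isSplit_update k e c hc hes, card_erase_of_mem he, hk]
        rfl
      have h0 : isSplit (0 : Fin 8) = false := by decide
      have h1 : isSplit (1 : Fin 8) = false := by decide
      rcases (isSplit_iff _).1 hes with h | h | h | h
      · have hr := (h2 α F k e).1 h
        have := ih _ (hcard 0 h0)
        linarith
      · have hr := (h3 α F k e).1 h
        have := ih _ (hcard 0 h0)
        linarith
      · have hr := (h2 α F k e).2 h
        have := ih _ (hcard 1 h1)
        linarith
      · have hr := (h3 α F k e).2 h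
        have := ih _ (hcard 1 h1)
        linarith
  intro k
  exact key _ k rfl

/-! ## The free cell is the partition functional -/

/-- Code `4` allows exactly the patterns "in exactly one copy". [this work] -/
theorem okPat_four : ∀ b1 b2 b3 : Bool, okPat 4 (patOf b1 b2 b3) = true ↔
    ((b1 = true ∧ b2 = false ∧ b3 = false) ∨ (b1 = false ∧ b2 = true ∧ b3 = false) ∨ (b1 = false ∧ b2 = false ∧ b3 = true)) := by
  unfold okPat patOf; decide

/-- Membership in the all-free cell: the three sets form an ordered 3-partition. [this work] -/
theorem inCell_free_iff (x y z : Finset α) :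
    inCell (fun _ => (4 : Fin 8)) x y z = true ↔ Disjoint x y ∧ z = (x ∪ y)ᶜ := by
  rw [inCell_iff]
  constructor
  · intro h
    have hpt : ∀ e, (e ∈ x ∧ e ∉ y ∧ e ∉ z) ∨ (e ∉ x ∧ e ∈ y ∧ e ∉ z) ∨ (e ∉ x ∧ e ∉ y ∧ e ∈ z) := by
      intro e
      have := (okPat_four _ _ _).1 (h e)
      simpa only [decide_eq_true_eq, decide_eq_false_iff_not] using this
    refine ⟨disjoint_left.2 fun e hex hey => ?_, ?_⟩
    · rcases hpt e with h1 | h1 | h1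
      · exact h1.2.1 hey
      · exact h1.1 hex
      · exact h1.1 hex
    · ext e
      simp only [mem_compl, mem_union, not_or]
      rcases hpt e with h1 | h1 | h1
      · exact ⟨fun hz => absurd hz h1.2.2, fun hn => absurd h1.1 hn.1⟩
      · exact ⟨fun hz => absurd hz h1.2.2, fun hn => absurd h1.2.1 hn.2⟩
      · exact ⟨fun _ => ⟨h1.1, h1.2.1⟩, fun _ => h1.2.2⟩
  · rintro ⟨hd, rfl⟩ e
    rw [okPat_four]
    by_cases hex : e ∈ x
    · have hey : e ∉ y := disjoint_left.1 hd hex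
      have hez : e ∉ (x ∪ y)ᶜ := fun h => (mem_compl.1 h) (mem_union.2 (Or.inl hex))
      exact Or.inl ⟨decide_eq_true hex, decide_eq_false hey, decide_eq_false hez⟩
    · by_cases hey : e ∈ y
      · have hez : e ∉ (x ∪ y)ᶜ := fun h => (mem_compl.1 h) (mem_union.2 (Or.inr hey))
        exact Or.inr (Or.inl ⟨decide_eq_false hex, decide_eq_true hey, decide_eq_false hez⟩)
      · have hez : e ∈ (x ∪ y)ᶜ := mem_compl.2 (fun h => (mem_union.1 h).elim hex hey)
        exact Or.inr (Or.inr ⟨decide_eq_false hex, decide_eq_false hey, decide_eq_true hez⟩)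

namespace Sunflower

variable (F : Sunflower α)

/-- **The all-free cell sum is the partition functional `ZH`.** [this work] -/
theorem G_free_eq_ZH : F.G (fun _ => (4 : Fin 8)) = F.ZH := by
  unfold G ZH parts
  symm
  refine sum_nbij' (fun q => (q.1, q.2, (q.1 ∪ q.2)ᶜ)) (fun t => (t.1, t.2.1)) ?_ ?_ ?_ ?_ ?_
  · intro q hq
    rw [mem_filter] at hq ⊢
    exact ⟨mem_univ _, (inCell_free_iff _ _ _).2 ⟨hq.2, rfl⟩⟩
  · intro t ht
    rw [mem_filter] at ht ⊢
    exact ⟨mem_univ _, ((inCell_free_iff _ _ _).1 ht.2).1⟩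
  · intro q _
    rfl
  · intro t ht
    rw [mem_filter] at ht
    have hz := ((inCell_free_iff _ _ _).1 ht.2).2
    ext <;> simp [hz]
  · intro q _
    rfl

end Sunflower

/-- `Thresh` implies the partition lemma ★ (the all-free cell). [this work] -/
theorem partitionLemmaH_of_thresh (h : Thresh) : PartitionLemmaH := by
  intro α _ _ F
  rw [← F.G_free_eq_ZH]
  exact h α F _

/-- **The two retention inequalities imply the partition lemma ★** (hence, with `…SunflowerCloneHqt` / `…SunflowerCloneGamma`, the law-level
cubic `H_{q+t} ≥ 0` and `GammaRow`). [this work] -/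
theorem partitionLemmaH_of_retention (h3 : Retention3) (h2 : Retention2) : PartitionLemmaH :=
  partitionLemmaH_of_thresh (thresh_of_retention h3 h2)

end Summit.CriticalPhenomena.PercolationContinuityZ3.Theorems.SunflowerPartition
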